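import Mathlib

/-!
# The kept triple sum, decomposed by the third position

Crux `Summit.MatrixMultiplication.MatrixMultiplication.Theses.SnSubsetDichotomy.PolynomialSlack`
(item `stmt-MatrixMultiplication-8306`), level-one programme, lead c8, line transport-split-hull.
The "kept" trilinear term `Σ_{i,j,k} (d_A(i,j) - 1/n)·p_B(j,k)·p_C(k,i)` of the level-one
inequality is a sum over the third position `k` of per-position contributions

  `c_k = Σ_{i,j} d_A(i,j) p_B(j,k) p_C(k,i) - (1/n)·(Σ_j p_B(j,k))·(Σ_i p_C(k,i))`

(`tripleSum_by_position`): pure finite-sum algebra (swap the `k`-sum to the outside, expand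
`(d_A - 1/n) p_B p_C`, and factor the product of the two marginal sums at position `k`).
-/

namespace Summit.MatrixMultiplication.MatrixMultiplication.Theorems.PolynomialSlack

open scoped BigOperators

-- `Summit.<Summit>.<Problem>` is the tree's mandated summit-side namespace (CONVENTIONS §2); for
-- this single-conjunct summit the two coincide, so each declaration silences `dupNamespace`.
set_option linter.dupNamespace false

/-- [folklore] The kept triple sum decomposes by the third position: for real arrays
`dA pB pC : Fin n → Fin n → ℝ`,
`Σ_i Σ_j Σ_k (dA i j - 1/n) pB j k pC k i
  = Σ_k (Σ_i Σ_j dA i j pB j k pC k i - (1/n)·(Σ_j pB j k)(Σ_i pC k i))`. -/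
theorem tripleSum_by_position {n : ℕ} (dA pB pC : Fin n → Fin n → ℝ) :
    ∑ i : Fin n, ∑ j : Fin n, ∑ k : Fin n, (dA i j - 1 / n) * pB j k * pC k i =
      ∑ k : Fin n, ((∑ i : Fin n, ∑ j : Fin n, dA i j * pB j k * pC k i) -
        1 / n * ((∑ j : Fin n, pB j k) * (∑ i : Fin n, pC k i))) := by
  -- move the `k`-sum to the outside: `Σ_i Σ_j Σ_k F = Σ_k Σ_i Σ_j F`
  have hswap : ∑ i : Fin n, ∑ j : Fin n, ∑ k : Fin n, (dA i j - 1 / n) * pB j k * pC k i =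
      ∑ k : Fin n, ∑ i : Fin n, ∑ j : Fin n, (dA i j - 1 / n) * pB j k * pC k i := by
    calc ∑ i : Fin n, ∑ j : Fin n, ∑ k : Fin n, (dA i j - 1 / n) * pB j k * pC k i
        = ∑ i : Fin n, ∑ k : Fin n, ∑ j : Fin n, (dA i j - 1 / n) * pB j k * pC k i :=
          Finset.sum_congr rfl fun i _ => Finset.sum_comm
      _ = ∑ k : Fin n, ∑ i : Fin n, ∑ j : Fin n, (dA i j - 1 / n) * pB j k * pC k i :=
          Finset.sum_comm
  rw [hswap]
  refine Finset.sum_congr rfl fun k _ => ?_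
  -- the product of the two marginal sums at position `k` is a double sum
  have hprod : (∑ j : Fin n, pB j k) * (∑ i : Fin n, pC k i) =
      ∑ i : Fin n, ∑ j : Fin n, pB j k * pC k i := by
    rw [Finset.sum_mul_sum, Finset.sum_comm]
  rw [hprod, Finset.mul_sum, ← Finset.sum_sub_distrib]
  refine Finset.sum_congr rfl fun i _ => ?_
  rw [Finset.mul_sum, ← Finset.sum_sub_distrib]
  refine Finset.sum_congr rfl fun j _ => ?_
  ring

end Summit.MatrixMultiplication.MatrixMultiplication.Theorems.PolynomialSlack
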